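import Mathlib
import Summits.Ventures.HodgeRepro2.T5UnitIndexValuation
import Summits.Ventures.HodgeRepro2.T5HigherUnitsIndex
import Summits.Ventures.HodgeRepro2.T5AdicCompletionIntegral
import Summits.Ventures.HodgeRepro2.T5AdicCompletionConductor
import Summits.Ventures.HodgeRepro2.T5UnramifiedCharacter
import Summits.Ventures.HodgeRepro2.T5AdicCompletionResidueField

/-!
# `[E_v^× : F_v^× U_E^n] = e · [O_{E_v}^× : O_{F_v}^× U_E^n]` on Mathlib's completions

The index formula of `T5UnitIndexValuation` instantiated on the concrete pair
`Kv := v.adicCompletion K ⊆ Lw := w.adicCompletion L` (number fields, Mathlib's `[Algebra Kv Lw]`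
`[ContinuousSMul Kv Lw]`): with `A = F_v^×` (the image of `Kvˣ`, `T5UnramifiedCharacter.baseUnits`),
`U = O_{Lw}ˣ` (the unit group of the valuation subring, = the image of `(O_{Lw})ˣ`), `V = U_E^n`
(the image of `higherUnits π n`) and `e` the ramification index (`w(ϖ) = exp (-e)` for a
uniformiser `ϖ` of `Kv`):

* `range_unitsMap_integers`: the image of `(O_{Lw})ˣ` in `Lwˣ` is the unit group `{w x = 1}`;
* `range_baseUnits_inf_unitGroup`: `F_v^× ∩ O_{Lw}ˣ` is the image of `(O_{Kv})ˣ`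
  (`T5ContinuousValuationExtension.val_algebraMap_eq_one_iff`);
* `index_range_baseUnits_sup_map_higherUnits`: THE COUNT
  `[Lwˣ : F_v^× ⊔ U_E^n] = e · [(O_{Lw})ˣ : O_{Kv}ˣ-image ⊔ U_E^n]`, `n ≥ 1` — Lemma N5.L4(iv-a)'s
  «`E_v^×/F_v^×U_E^{2t+1}` is finite» (`index_ne_zero_…`, `finite_quotient_…`) and Lemma
  N5.L4(iii)'s «`E_v^×/F_v^×U_E^n` has order `[U_E : U_F U_E^n]`» (inert: `e = 1`,
  `index_…_of_quadratic_inert` = `(q+1)q^{n-1}` by `T5HigherUnitsIndex.index_sup_eq_of_card`).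

Declaration per README §8(d): «uses an L-value-free non-vanishing device: NO».
-/

namespace Summit.Ventures.HodgeRepro2.T5AdicCompletionUnitIndex

open IsDedekindDomain HeightOneSpectrum T5PrincipalUnitFiltration T5PrincipalUnitComparison
  T5UnitIndexValuation

section General

variable {R : Type*} [CommRing R] [IsDedekindDomain R] {K : Type*} [Field K] [Algebra R K]
  [IsFractionRing R K] (v : HeightOneSpectrum R)

/-- The image of `(O_{Kv})ˣ` in `Kvˣ` is the unit group of the valuation subring, `{x ∣ v x = 1}`. -/
theorem range_unitsMap_integers :
    (Units.map (algebraMap (adicCompletionIntegers K v) (adicCompletion K v) :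
      adicCompletionIntegers K v →* adicCompletion K v)).range =
      (Valued.v (R := adicCompletion K v)).valuationSubring.unitGroup := by
  ext x
  rw [MonoidHom.mem_range]
  constructor
  · rintro ⟨u, rfl⟩
    exact (adicCompletionIntegers K v).valuation_unit u
  · intro hx
    exact ⟨(adicCompletionIntegers K v).unitGroupMulEquiv ⟨x, hx⟩,
      Units.ext ((adicCompletionIntegers K v).coe_unitGroupMulEquiv_apply ⟨x, hx⟩)⟩

/-- The inclusion `(O_{Kv})ˣ → Kvˣ` is injective. -/
theorem injective_unitsMap_integers :
    Function.Injective (Units.map (algebraMap (adicCompletionIntegers K v) (adicCompletion K v) :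
      adicCompletionIntegers K v →* adicCompletion K v)) :=
  Units.map_injective Subtype.val_injective

/-- The image of `U^n` in `Kvˣ` lies in the unit group. -/
theorem map_higherUnits_le_unitGroup (π : adicCompletionIntegers K v) (n : ℕ) :
    (higherUnits π n).map (Units.map (algebraMap (adicCompletionIntegers K v)
      (adicCompletion K v) : adicCompletionIntegers K v →* adicCompletion K v)) ≤
      (Valued.v (R := adicCompletion K v)).valuationSubring.unitGroup := by
  rw [← range_unitsMap_integers v]
  exact Subgroup.map_le_range _ _

end General

section Pair

variable {K : Type*} [Field K] [NumberField K] (v : HeightOneSpectrum (NumberField.RingOfIntegers K))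
variable {L : Type*} [Field L] [NumberField L]
  (w : HeightOneSpectrum (NumberField.RingOfIntegers L))
variable [Algebra (adicCompletion K v) (adicCompletion L w)]
  [ContinuousSMul (adicCompletion K v) (adicCompletion L w)]

/-- `F_v^× ∩ O_{Lw}ˣ` = the image of `(O_{Kv})ˣ` in `Lwˣ` (through `(O_{Lw})ˣ`). -/
theorem range_baseUnits_inf_unitGroup :
    (T5UnramifiedCharacter.baseUnits v w).range ⊓
      (Valued.v (R := adicCompletion L w)).valuationSubring.unitGroup =
      (unitsMap (R := adicCompletionIntegers K v) (S := adicCompletionIntegers L w)).range.map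
        (Units.map (algebraMap (adicCompletionIntegers L w) (adicCompletion L w) :
          adicCompletionIntegers L w →* adicCompletion L w)) := by
  ext x
  rw [Subgroup.mem_inf, MonoidHom.mem_range, Subgroup.mem_map]
  constructor
  · rintro ⟨⟨y, rfl⟩, hy⟩
    rw [Valuation.mem_unitGroup_iff, Units.coe_map] at hy
    change Valued.v (algebraMap (adicCompletion K v) (adicCompletion L w) (y : adicCompletion K v))
      = 1 at hy
    rw [T5ContinuousValuationExtension.val_algebraMap_eq_one_iff] at hy
    -- `y` is a unit of `O_{Kv}`
    obtain ⟨r, hr⟩ : y ∈ (Units.map (algebraMap (adicCompletionIntegers K v) (adicCompletion K v) :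
        adicCompletionIntegers K v →* adicCompletion K v)).range := by
      rw [range_unitsMap_integers v, Valuation.mem_unitGroup_iff]
      exact hy
    refine ⟨unitsMap r, ⟨r, rfl⟩, ?_⟩
    rw [← hr]
    apply Units.ext
    simp only [Units.coe_map, T5UnramifiedCharacter.baseUnits]
    change algebraMap (adicCompletionIntegers L w) (adicCompletion L w)
      (algebraMap (adicCompletionIntegers K v) (adicCompletionIntegers L w) r) =
      algebraMap (adicCompletion K v) (adicCompletion L w)
        (algebraMap (adicCompletionIntegers K v) (adicCompletion K v) r)
    rw [← IsScalarTower.algebraMap_apply, ← IsScalarTower.algebraMap_apply]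
  · rintro ⟨_, ⟨r, rfl⟩, rfl⟩
    refine ⟨⟨Units.map (algebraMap (adicCompletionIntegers K v) (adicCompletion K v) :
      adicCompletionIntegers K v →* adicCompletion K v) r, ?_⟩,
      (adicCompletionIntegers L w).valuation_unit (unitsMap r)⟩
    apply Units.ext
    simp only [Units.coe_map, T5UnramifiedCharacter.baseUnits]
    change algebraMap (adicCompletion K v) (adicCompletion L w)
      (algebraMap (adicCompletionIntegers K v) (adicCompletion K v) r) =
      algebraMap (adicCompletionIntegers L w) (adicCompletion L w)
        (algebraMap (adicCompletionIntegers K v) (adicCompletionIntegers L w) r)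
    rw [← IsScalarTower.algebraMap_apply, ← IsScalarTower.algebraMap_apply]

/-- Every element of `F_v^×` has valuation a power of `exp (-e)` (`w ∘ alg = v^e`). -/
theorem exists_val_baseUnits_eq_pow {ϖ : adicCompletion K v}
    (hϖ : Valued.v ϖ = WithZero.exp (-1)) {e : ℕ} (he0 : 0 < e)
    (he : Valued.v (algebraMap (adicCompletion K v) (adicCompletion L w) ϖ) =
      WithZero.exp (-(e : ℤ)))
    (x : (adicCompletion L w)ˣ) (hx : x ∈ (T5UnramifiedCharacter.baseUnits v w).range) :
    ∃ k : ℤ, Valued.v (x : adicCompletion L w) = WithZero.exp (-(e : ℤ)) ^ k := by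
  obtain ⟨y, rfl⟩ := hx
  have hy0 : Valued.v (y : adicCompletion K v) ≠ 0 := by
    rw [Valuation.ne_zero_iff]
    exact y.ne_zero
  refine ⟨-(Valued.v (y : adicCompletion K v)).log, ?_⟩
  have h1 : Valued.v ((T5UnramifiedCharacter.baseUnits v w y : (adicCompletion L w)ˣ) :
      adicCompletion L w) = Valued.v (y : adicCompletion K v) ^ e := by
    simp only [T5UnramifiedCharacter.baseUnits, Units.coe_map]
    exact T5AdicCompletionIntegral.val_algebraMap_eq_pow v w hϖ he0 he y
  rw [h1, ← WithZero.exp_zsmul, neg_smul, smul_neg, neg_neg, smul_eq_mul, mul_comm, ← nsmul_eq_mul,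
    WithZero.exp_nsmul, WithZero.exp_log hy0]

omit [ContinuousSMul (adicCompletion K v) (adicCompletion L w)] in
/-- `exp (-e)` is attained on `F_v^×` (by the uniformiser `ϖ` of `Kv`). -/
theorem exists_mem_baseUnits_val_eq {ϖ : adicCompletion K v}
    (hϖ : Valued.v ϖ = WithZero.exp (-1)) {e : ℕ}
    (he : Valued.v (algebraMap (adicCompletion K v) (adicCompletion L w) ϖ) =
      WithZero.exp (-(e : ℤ))) :
    ∃ x ∈ (T5UnramifiedCharacter.baseUnits v w).range,
      Valued.v (x : adicCompletion L w) = WithZero.exp (-(e : ℤ)) := by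
  have hϖ0 : ϖ ≠ 0 := by
    rintro rfl
    rw [Valuation.map_zero] at hϖ
    exact WithZero.exp_ne_zero hϖ.symm
  refine ⟨T5UnramifiedCharacter.baseUnits v w (Units.mk0 ϖ hϖ0), ⟨_, rfl⟩, ?_⟩
  simp only [T5UnramifiedCharacter.baseUnits, Units.coe_map, Units.val_mk0]
  exact he

/-- THE COUNT on the concrete pair: for `n ≥ 1` (so that `U_E^n` is a subgroup of the units)
`[Lwˣ : F_v^× ⊔ U_E^n] = e · [(O_{Lw})ˣ : (image of (O_{Kv})ˣ) ⊔ U_E^n]`, `e` the ramification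
index (`w(ϖ) = exp (-e)` for a uniformiser `ϖ` of `Kv`). -/
theorem index_range_baseUnits_sup_map_higherUnits {ϖ : adicCompletion K v}
    (hϖ : Valued.v ϖ = WithZero.exp (-1)) {e : ℕ} (he0 : 0 < e)
    (he : Valued.v (algebraMap (adicCompletion K v) (adicCompletion L w) ϖ) =
      WithZero.exp (-(e : ℤ)))
    (π : adicCompletionIntegers L w) (n : ℕ) :
    ((T5UnramifiedCharacter.baseUnits v w).range ⊔ (higherUnits π n).map
      (Units.map (algebraMap (adicCompletionIntegers L w) (adicCompletion L w) :
        adicCompletionIntegers L w →* adicCompletion L w))).index =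
      e * ((unitsMap (R := adicCompletionIntegers K v) (S := adicCompletionIntegers L w)).range ⊔
        higherUnits π n).index := by
  rw [index_sup_eq_mul (Valued.v (R := adicCompletion L w)) (valuedAdicCompletion_surjective L w)
    _ _ (map_higherUnits_le_unitGroup w π n) e
    (fun x hx => exists_val_baseUnits_eq_pow v w hϖ he0 he x hx)
    (exists_mem_baseUnits_val_eq v w hϖ he), range_baseUnits_inf_unitGroup v w,
    ← Subgroup.map_sup, ← range_unitsMap_integers w,
    MonoidHom.range_eq_map (Units.map (algebraMap (adicCompletionIntegers L w) (adicCompletion L w) :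
      adicCompletionIntegers L w →* adicCompletion L w)),
    Subgroup.relIndex_map_map_of_injective _ _ (injective_unitsMap_integers w),
    Subgroup.relIndex_top_right]

/-- The same with `e` produced by `T5AdicCompletionIntegral.exists_val_algebraMap_eq_exp_neg`:
for every uniformiser `ϖ` of `Kv` there is `e ≥ 1` with the count above. -/
theorem exists_index_range_baseUnits_sup_map_higherUnits {ϖ : adicCompletion K v}
    (hϖ : Valued.v ϖ = WithZero.exp (-1)) (π : adicCompletionIntegers L w) (n : ℕ) :
    ∃ e : ℕ, 0 < e ∧
      Valued.v (algebraMap (adicCompletion K v) (adicCompletion L w) ϖ) =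
        WithZero.exp (-(e : ℤ)) ∧
      ((T5UnramifiedCharacter.baseUnits v w).range ⊔ (higherUnits π n).map
        (Units.map (algebraMap (adicCompletionIntegers L w) (adicCompletion L w) :
          adicCompletionIntegers L w →* adicCompletion L w))).index =
        e * ((unitsMap (R := adicCompletionIntegers K v) (S := adicCompletionIntegers L w)).range ⊔
        higherUnits π n).index := by
  obtain ⟨e, he0, he⟩ := T5AdicCompletionIntegral.exists_val_algebraMap_eq_exp_neg v w hϖ
  exact ⟨e, he0, he, index_range_baseUnits_sup_map_higherUnits v w hϖ he0 he π n⟩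

/-- Lemma N5.L4(iv-a)'s «`E_v^×/H` is finite»: `F_v^× ⊔ U_E^n` has finite index in `Lwˣ` as soon as
`(O_{Kv})ˣ-image ⊔ U_E^n` has finite index in `(O_{Lw})ˣ` (true for `n ≥ 1`, `π` a uniformiser:
`T5HigherUnitsIndex.index_higherUnits`). -/
theorem index_range_baseUnits_sup_map_higherUnits_ne_zero {ϖ : adicCompletion K v}
    (hϖ : Valued.v ϖ = WithZero.exp (-1)) (π : adicCompletionIntegers L w) (n : ℕ)
    (hn : ((unitsMap (R := adicCompletionIntegers K v) (S := adicCompletionIntegers L w)).range ⊔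
      higherUnits π n).index ≠ 0) :
    ((T5UnramifiedCharacter.baseUnits v w).range ⊔ (higherUnits π n).map
      (Units.map (algebraMap (adicCompletionIntegers L w) (adicCompletion L w) :
        adicCompletionIntegers L w →* adicCompletion L w))).index ≠ 0 := by
  obtain ⟨e, he0, -, he⟩ := exists_index_range_baseUnits_sup_map_higherUnits v w hϖ π n
  rw [he]
  exact mul_ne_zero he0.ne' hn

/-- The unit-level index is non-zero for `n ≥ 1` and `π` a uniformiser: `U^n` already has finite
index `|kˣ|·|k|^{n-1}` in `(O_{Lw})ˣ` (`T5HigherUnitsIndex.index_higherUnits`). -/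
theorem index_range_sup_higherUnits_ne_zero {π : adicCompletionIntegers L w} (hπ : Irreducible π)
    {n : ℕ} (hn : 1 ≤ n) :
    ((unitsMap (R := adicCompletionIntegers K v) (S := adicCompletionIntegers L w)).range ⊔
      higherUnits π n).index ≠ 0 := by
  intro h
  have h1 : (higherUnits π n).index = 0 :=
    zero_dvd_iff.mp (h ▸ Subgroup.index_dvd_of_le le_sup_right)
  rw [T5HigherUnitsIndex.index_higherUnits hπ hn] at h1
  exact mul_ne_zero Nat.card_pos.ne' (pow_ne_zero _ Nat.card_pos.ne') h1

/-- Lemma N5.L4(iv-a), kernel form: for `π` a uniformiser of `Lw` and `n ≥ 1`, `F_v^× U_E^n` has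
FINITE index in `Lwˣ` (hence `E_v^×/F_v^×U_E^n` is a finite group). -/
theorem finite_quotient_range_baseUnits_sup_map_higherUnits {ϖ : adicCompletion K v}
    (hϖ : Valued.v ϖ = WithZero.exp (-1)) {π : adicCompletionIntegers L w} (hπ : Irreducible π)
    {n : ℕ} (hn : 1 ≤ n) :
    Finite ((adicCompletion L w)ˣ ⧸ ((T5UnramifiedCharacter.baseUnits v w).range ⊔
      (higherUnits π n).map (Units.map (algebraMap (adicCompletionIntegers L w)
        (adicCompletion L w) : adicCompletionIntegers L w →* adicCompletion L w)))) :=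
  Subgroup.index_ne_zero_iff_finite.mp
    (index_range_baseUnits_sup_map_higherUnits_ne_zero v w hϖ π n
      (index_range_sup_higherUnits_ne_zero v w hπ hn))

/-- Lemma N5.L4(iii)'s COUNT at an INERT place (`ϖ` stays a uniformiser of `Lw`, residue fields of
orders `q` and `q²`): `[Lwˣ : F_v^× U_E^n] = (q+1)·q^{n-1}` for `n ≥ 1` — the order of
`E_v^×/F_v^×U_E^n`, the group whose characters are the conjugate-orthogonal characters of
conductor `≤ n`. -/
theorem index_range_baseUnits_sup_map_higherUnits_of_inert {ϖ : adicCompletionIntegers K v}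
    (hϖ : Irreducible ϖ)
    (hϖL : Irreducible (algebraMap (adicCompletionIntegers K v) (adicCompletionIntegers L w) ϖ))
    {n : ℕ} (hn : 1 ≤ n) {q : ℕ} (hq : 2 ≤ q)
    (hk : Nat.card (IsLocalRing.ResidueField (adicCompletionIntegers K v)) = q)
    (hku : Nat.card (IsLocalRing.ResidueField (adicCompletionIntegers K v))ˣ = q - 1)
    (hK : Nat.card (IsLocalRing.ResidueField (adicCompletionIntegers L w)) = q ^ 2)
    (hKu : Nat.card (IsLocalRing.ResidueField (adicCompletionIntegers L w))ˣ = q ^ 2 - 1) :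
    ((T5UnramifiedCharacter.baseUnits v w).range ⊔
      (higherUnits (algebraMap (adicCompletionIntegers K v) (adicCompletionIntegers L w) ϖ) n).map
        (Units.map (algebraMap (adicCompletionIntegers L w) (adicCompletion L w) :
          adicCompletionIntegers L w →* adicCompletion L w))).index = (q + 1) * q ^ (n - 1) := by
  have hϖv : Valued.v (ϖ : adicCompletion K v) = WithZero.exp (-1) :=
    (T5AdicCompletionConductor.irreducible_iff_val_eq_exp_neg_one v ϖ).mp hϖ
  have he1 : Valued.v (algebraMap (adicCompletion K v) (adicCompletion L w) (ϖ : adicCompletion K v))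
      = WithZero.exp (-((1 : ℕ) : ℤ)) := by
    have h := (T5AdicCompletionConductor.irreducible_iff_val_eq_exp_neg_one w _).mp hϖL
    have h2 : algebraMap (adicCompletion K v) (adicCompletion L w)
        (algebraMap (adicCompletionIntegers K v) (adicCompletion K v) ϖ) =
        algebraMap (adicCompletionIntegers L w) (adicCompletion L w)
          (algebraMap (adicCompletionIntegers K v) (adicCompletionIntegers L w) ϖ) := by
      rw [← IsScalarTower.algebraMap_apply, ← IsScalarTower.algebraMap_apply]
    rw [Nat.cast_one, ← h]
    exact congrArg _ h2
  rw [index_range_baseUnits_sup_map_higherUnits v w hϖv one_pos he1 _ n,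
    T5HigherUnitsIndex.index_sup_eq_of_card
      T5ContinuousValuationExtension.algebraMap_adicCompletionIntegers_injective hϖ hϖL hn hq
      hk hku hK hKu, one_mul]

end Pair

end Summit.Ventures.HodgeRepro2.T5AdicCompletionUnitIndex
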